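import Literature.AlgebraicGeometry.Resolution.KawasakiProductCharts
import Literature.AlgebraicGeometry.Resolution.KawasakiBlowupPeeling
import Literature.AlgebraicGeometry.Resolution.CohenMacaulayLocalization
import Literature.AlgebraicGeometry.Resolution.BlowupDimension
import HarnessLib

/-!
# Kawasaki's theorem: the blow-up of a local domain along the Kawasaki centre is Cohen–Macaulay

Topic: `Literature/AlgebraicGeometry/Resolution`. This file turns the local cohomology vanishing of
`KawasakiBlowupInduction.lean` (`AdmChart.cechVanishBelow`: `Hʲ_𝔔(R[I/g]) = 0` for `j < d` at
the maximal ideals `𝔔 ⊇ 𝔪` of the recursive charts `R[I/g]` of `Bl_I(Spec R)`,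
`I = ∏_{t<d} (x_{t+1},…,x_d)`, for a `p`-standard system `x_1,…,x_d` of the Noetherian local
domain `R` with `dim R ≤ d`) into the Cohen–Macaulay property of all local rings of `Bl_I(Spec R)`
at points over the closed point (Kawasaki 2000, Thm. 4.1 (1) for `M = R`; Česnavičius 2021,
Thm. 3.13): depth `≥ d` by the Čech–Koszul bridge
(`CechVanishBelow.exists_isWeaklyRegular`), dimension `≤ d` by Matsumura 15.5
(`ringKrullDim_localization_le_of_finiteType_of_isAlgebraic`), Cohen–Macaulayness of
localizations (`cmClause_of_isLocalization_atPrime`), and the passage from the recursive charts to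
all product charts `R[I/G_f]` (`KawasakiProductCharts.lean`, `BlowupChartsFractionField.lean`).

* `chartModuleSelfEquiv` — `R[I/g] ≅ R_{(g)}` as a module over `R[I/g]`;
* `cmClause_of_cechVanishBelow` — Čech vanishing below `d` at a maximal ideal `𝔔` with
  `dim ≤ d` gives the CM clause for the localizations at `𝔔`;
* `cmClause_localization_of_le` — CM passes from `A_𝔔` to `A_𝔴` for primes `𝔴 ⊆ 𝔔`;
* `cmClause_of_admChart` — recursive charts; `cmClause_of_adm` — all product charts;
* `cmClause_of_admChart_of_isWeaklyRegular`, `cmClause_of_adm_of_isWeaklyRegular` — the same when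
  `xs` is only part of a system of parameters and `R/(xs)` is Cohen–Macaulay (an `R/(xs)`-regular
  `Z ⊆ 𝔪` with `dim R ≤ |xs| + |Z|`; Kawasaki 2000, Thm. 4.1 "furthermore"/Cor. 4.2, `t > 1`),
  via `KawasakiBlowupPeeling.lean`;
* `exists_isLocalization_atPrime_crec` — every local ring of a product chart at a prime is a
  local ring of the attached recursive chart at a prime with the same contraction to `R`.

Everything is proved; no named facts.

## References

* [Kawasaki2000] T. Kawasaki, *On Macaulayfication of Noetherian schemes*, Trans. AMS 352 (2000),
  Thm. 4.1.
* [Cesnavicius2021] K. Česnavičius, *Macaulayfication of Noetherian schemes*, Duke Math. J. 170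
  (2021), Thm. 3.13 and its proof.
* [Matsumura1987] H. Matsumura, *Commutative Ring Theory*, Thms. 15.5, 17.3, 17.4.
-/

noncomputable section

open IsLocalRing Ideal IsLocalization RingTheory.Sequence
  Literature.RingTheory.LocalCohomology Literature.RingTheory.TightClosure

namespace Literature.AlgebraicGeometry.Resolution

universe u

/-! ## `R[I/g] ≅ R_{(g)}` -/

section SelfChart

variable {R : Type u} [CommRing R] (I : Ideal R) (g : R)

/-- The generator `1/1 ∈ R_{(g)} ⊆ R[1/g]`. [folklore] -/
def chartModuleOne : chartModule I g R :=
  ⟨LocalizedModule.mkLinearMap (Submonoid.powers g) R 1, mkLinearMap_mem_chartModule I g (1 : R)⟩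

/-- `a ↦ a · (1/1)`, `R[I/g] → R_{(g)}`. [folklore] -/
def toChartModuleSelf : blowupAlgebra I g →ₗ[blowupAlgebra I g] chartModule I g R :=
  LinearMap.toSpanSingleton (blowupAlgebra I g) (chartModule I g R) (chartModuleOne I g)

/-- `toChartModuleSelf a = a • (1/1)` in `R[1/g]`. [folklore] -/
theorem coe_toChartModuleSelf (a : blowupAlgebra I g) :
    (toChartModuleSelf I g a : LocalizedModule (Submonoid.powers g) R) =
      (a : Localization.Away g) • LocalizedModule.mkLinearMap (Submonoid.powers g) R 1 := rfl

/-- `gⁿ · ((y/gⁿ) · (1/1)) = y/1`. [folklore] -/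
theorem pow_smul_mul_invSelf_pow_smul_one (n : ℕ) (y : R) :
    g ^ n • ((algebraMap R (Localization.Away g) y * Away.invSelf g ^ n) •
      LocalizedModule.mkLinearMap (Submonoid.powers g) R 1) =
      LocalizedModule.mkLinearMap (Submonoid.powers g) R y := by
  rw [mul_smul, algebraMap_smul, smul_comm (g ^ n) y, pow_smul_invSelf_pow_smul,
    ← LinearMap.map_smul, smul_eq_mul, mul_one]

/-- `R[I/g] → R_{(g)}` is surjective (`g ∈ I`). [folklore] -/
theorem toChartModuleSelf_surjective (hg : g ∈ I) : Function.Surjective (toChartModuleSelf I g) := by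
  intro x
  obtain ⟨n, m, hm, hx⟩ := (mem_chartModule_iff I g R hg (x : LocalizedModule _ R)).mp x.2
  rw [Ideal.smul_eq_mul, Ideal.mul_top] at hm
  refine ⟨blowupAlgebra.divPow I g hm, Subtype.ext (pow_smul_injective g R n ?_)⟩
  dsimp only
  rw [hx, coe_toChartModuleSelf, blowupAlgebra.coe_divPow, pow_smul_mul_invSelf_pow_smul_one]

/-- `R[I/g] → R_{(g)}` is injective when `g` is a non-zero-divisor (`g ∈ I`). [folklore] -/
theorem toChartModuleSelf_injective (hg : g ∈ I) (hg0 : g ∈ nonZeroDivisors R) :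
    Function.Injective (toChartModuleSelf I g) := by
  rw [injective_iff_map_eq_zero]
  intro a ha
  obtain ⟨n, y, -, hay⟩ := blowupAlgebra.exists_eq_mul_invSelf_pow I g hg a.2
  have h0 : LocalizedModule.mkLinearMap (Submonoid.powers g) R y = 0 := by
    rw [← pow_smul_mul_invSelf_pow_smul_one g n y, ← hay, ← coe_toChartModuleSelf, ha,
      Submodule.coe_zero, smul_zero]
  obtain ⟨⟨_, e, rfl⟩, he⟩ :=
    (IsLocalizedModule.eq_zero_iff (Submonoid.powers g)
      (LocalizedModule.mkLinearMap (Submonoid.powers g) R)).mp h0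
  rw [Submonoid.smul_def, smul_eq_mul] at he
  change g ^ e * y = 0 at he
  rw [mul_left_mem_nonZeroDivisors_eq_zero_iff (pow_mem hg0 e)] at he
  apply Subtype.ext
  rw [hay, he, map_zero, zero_mul, Subalgebra.coe_zero]

/-- **`R[I/g] ≅ R_{(g)} = R[I/g] · R ⊆ R[1/g]`** as modules over `R[I/g]` (`g ∈ I` a
non-zero-divisor). [cite: Cesnavicius2021, §3.12] -/
def chartModuleSelfEquiv (hg : g ∈ I) (hg0 : g ∈ nonZeroDivisors R) :
    blowupAlgebra I g ≃ₗ[blowupAlgebra I g] chartModule I g R :=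
  LinearEquiv.ofBijective (toChartModuleSelf I g)
    ⟨toChartModuleSelf_injective I g hg hg0, toChartModuleSelf_surjective I g hg⟩

/-- `R ≅ R/(∅)R`. [folklore] -/
def quotOfListNilEquiv : (R ⧸ (Ideal.ofList ([] : List R) • ⊤ : Submodule R R)) ≃ₗ[R] R :=
  Submodule.quotEquivOfEqBot _ (by rw [Ideal.ofList_nil, Submodule.bot_smul])

end SelfChart

/-! ## From Čech vanishing to the Cohen–Macaulay clause -/

section CM

/-- Transport of the inline Cohen–Macaulay clause along a ring isomorphism (cf.
`cmClause_of_ringEquiv` of `PrincipalizationFromMacaulayfication.lean`, re-proved to keep the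
imports small). [folklore] -/
theorem cmClause_of_ringEquiv' {A B : Type u} [CommRing A] [CommRing B] (e : A ≃+* B)
    (hcm : ∀ d : ℕ, ringKrullDim A = d → ∀ s : Fin d → A,
      (Ideal.span (Set.range s)).radical.IsMaximal → IsWeaklyRegular A (List.ofFn s)) :
    ∀ d : ℕ, ringKrullDim B = d → ∀ s : Fin d → B,
      (Ideal.span (Set.range s)).radical.IsMaximal → IsWeaklyRegular B (List.ofFn s) := by
  intro d hd s hmax
  have hdA : ringKrullDim A = d := by rw [ringKrullDim_eq_of_ringEquiv e, hd]
  have hI : Ideal.span (Set.range (e.symm ∘ s)) = (Ideal.span (Set.range s)).comap e := by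
    rw [Set.range_comp, ← Ideal.map_span, Ideal.map_symm]
  have hmaxA : (Ideal.span (Set.range (e.symm ∘ s))).radical.IsMaximal := by
    rw [hI, ← Ideal.comap_radical]
    exact Ideal.comap_isMaximal_of_equiv e
  have hreg := hcm d hdA (e.symm ∘ s) hmaxA
  have hmap : List.ofFn s = (List.ofFn (e.symm ∘ s)).map e := by
    rw [List.map_ofFn]
    congr 1
    funext i
    simp
  rw [hmap]
  refine (AddEquiv.isWeaklyRegular_congr (e := e.toAddEquiv) ?_).mp hreg
  refine List.forall₂_map_right_iff.mpr (List.forall₂_same.mpr fun r _ x => ?_)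
  change e (r * x) = e r * e x
  exact map_mul e r x

/-- **Depth `≥ d` and `dim ≤ d` give Cohen–Macaulayness** at a maximal ideal: if
`Hʲ_{(y)}(A) = 0` for `j < d` with `(y) = 𝔔` maximal, then every localization `S` of `A` at `𝔔`
with `dim S ≤ d` satisfies the CM clause — the `d` elements of `𝔔` forming an `A`-weakly-regular
sequence (`CechVanishBelow.exists_isWeaklyRegular`) become a regular sequence of `S`, of which the
first `dim S` members witness Cohen–Macaulayness. [cite: Cesnavicius2021, Thm. 3.13 (proof, first
paragraph)] [cite: Matsumura1987, Thm. 17.4] -/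
theorem cmClause_of_cechVanishBelow {A : Type u} [CommRing A] [IsNoetherianRing A]
    {t : ℕ} {y : Fin t → A} {𝔔 : Ideal A} [𝔔.IsMaximal] (hy : Ideal.span (Set.range y) = 𝔔)
    {d : ℕ} (h : CechVanishBelow y A d)
    (S : Type u) [CommRing S] [Algebra A S] [IsLocalization.AtPrime S 𝔔]
    (hdim : ringKrullDim S ≤ d) :
    ∀ n : ℕ, ringKrullDim S = n → ∀ s : Fin n → S,
      (Ideal.span (Set.range s)).radical.IsMaximal → IsWeaklyRegular S (List.ofFn s) := by
  haveI := IsLocalization.AtPrime.isLocalRing S 𝔔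
  haveI : IsNoetherianRing S := IsLocalization.isNoetherianRing 𝔔.primeCompl S inferInstance
  obtain ⟨rs, hlen, hreg, hmem⟩ := h.exists_isWeaklyRegular
  rw [hy] at hmem
  have hregS : IsRegular S (rs.map (algebraMap A S)) :=
    hreg.isRegular_of_isLocalization_of_mem S 𝔔 hmem
  intro n hn s hs
  have hnd : n ≤ d := by
    rw [hn] at hdim
    exact_mod_cast hdim
  -- the first `n` members
  set rs' := (rs.map (algebraMap A S)).take n with hrs'
  have hmem' : ∀ r ∈ rs', r ∈ maximalIdeal S := fun r hr => by
    obtain ⟨a, ha, rfl⟩ := List.mem_map.mp (List.mem_of_mem_take hr)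
    exact (IsLocalization.AtPrime.to_map_mem_maximal_iff S 𝔔 a).mpr (hmem a ha)
  have hweak : IsWeaklyRegular S rs' := by
    have := hregS.1
    rw [← List.take_append_drop n (rs.map (algebraMap A S)), isWeaklyRegular_append_iff] at this
    exact this.1
  have hreg' : IsRegular S rs' :=
    (IsLocalRing.isRegular_iff_isWeaklyRegular_of_subset_maximalIdeal hmem').mpr hweak
  have hlen' : (rs'.length : WithBot ℕ∞) = ringKrullDim S := by
    rw [hrs', List.length_take, List.length_map, hlen, min_eq_left hnd, hn]
  exact isWeaklyRegular_of_isSystemOfParameters ⟨rs', hreg', hmem', hlen'⟩ s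
    (isSystemOfParameters_iff.mpr ⟨hn, hs⟩)

/-- **Cohen–Macaulayness descends to primes inside `𝔔`**: if the localizations of the Noetherian
ring `A` at the prime `𝔔` satisfy the CM clause, so do the localizations at every prime `𝔴 ⊆ 𝔔`
(`A_𝔴` is a localization of the local ring `A_𝔔`; Matsumura 17.3 (iii)).
[cite: Matsumura1987, Thm. 17.3 (iii)] -/
theorem cmClause_localization_of_le {A : Type u} [CommRing A] [IsNoetherianRing A]
    {𝔔 : Ideal A} [𝔔.IsPrime]
    (h𝔔 : ∀ n : ℕ, ringKrullDim (Localization.AtPrime 𝔔) = n →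
      ∀ s : Fin n → Localization.AtPrime 𝔔, (Ideal.span (Set.range s)).radical.IsMaximal →
        IsWeaklyRegular (Localization.AtPrime 𝔔) (List.ofFn s))
    {𝔴 : Ideal A} [𝔴.IsPrime] (hle : 𝔴 ≤ 𝔔)
    (S : Type u) [CommRing S] [Algebra A S] [IsLocalization.AtPrime S 𝔴] :
    ∀ n : ℕ, ringKrullDim S = n → ∀ s : Fin n → S,
      (Ideal.span (Set.range s)).radical.IsMaximal → IsWeaklyRegular S (List.ofFn s) := by
  set L := Localization.AtPrime 𝔔 with hL
  have hdisj : Disjoint (𝔔.primeCompl : Set A) 𝔴 := by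
    rw [Set.disjoint_left]
    intro a ha ha'
    exact ha (hle ha')
  set p : Ideal L := 𝔴.map (algebraMap A L) with hp
  haveI hpP : p.IsPrime := IsLocalization.isPrime_of_isPrime_disjoint 𝔔.primeCompl L 𝔴 ‹_› hdisj
  have hcomap : p.comap (algebraMap A L) = 𝔴 := by
    rw [← Ideal.under_def]
    exact IsLocalization.under_map_of_isPrime_disjoint 𝔔.primeCompl L ‹𝔴.IsPrime› hdisj
  -- `T = L_p` is CM, being a localization of the local CM ring `L`
  haveI : IsNoetherianRing L := IsLocalization.isNoetherianRing 𝔔.primeCompl L inferInstance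
  have hT := cmClause_of_isLocalization_atPrime h𝔔 p (Localization.AtPrime p)
  -- and `T` is the localization of `A` at `𝔴`
  have hM : (p.comap (algebraMap A L)).primeCompl = 𝔴.primeCompl :=
    Submonoid.ext fun x => by
      change x ∉ p.comap (algebraMap A L) ↔ x ∉ 𝔴
      rw [hcomap]
  have h1 : IsLocalization (p.comap (algebraMap A L)).primeCompl (Localization.AtPrime p) :=
    IsLocalization.isLocalization_atPrime_localization_atPrime 𝔔.primeCompl p
  rw [hM] at h1
  haveI : IsLocalization.AtPrime (Localization.AtPrime p) 𝔴 := h1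
  exact cmClause_of_ringEquiv'
    (IsLocalization.algEquiv 𝔴.primeCompl (Localization.AtPrime p) S).toRingEquiv hT

/-- The maximal ideals over `𝔪` and the submonoid bookkeeping: `M.map e = (P.comap e⁻¹)ᶜ`.
[folklore] -/
theorem primeCompl_map_ringEquiv_comap_symm {A B : Type*} [CommRing A] [CommRing B] (e : A ≃+* B)
    (P : Ideal A) [P.IsPrime] :
    P.primeCompl.map e = (P.comap e.symm.toRingHom).primeCompl := by
  ext x
  constructor
  · rintro ⟨y, hy, rfl⟩
    change ¬ e.symm.toRingHom (e y) ∈ P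
    rwa [show e.symm.toRingHom (e y) = y from e.symm_apply_apply y]
  · intro hx
    exact ⟨e.symm x, hx, e.apply_symm_apply x⟩

end CM

/-! ## The recursive charts are Cohen–Macaulay over the closed point -/

section Charts

variable {R : Type u} [CommRing R] [IsDomain R] [IsNoetherianRing R] [IsLocalRing R]
variable {xs : List R}

omit [IsDomain R] [IsNoetherianRing R] [IsLocalRing R] in
/-- The members of a secant sequence of a nonzero module are nonzero: a zero member would not
lower the dimension. [cite: Cesnavicius2021, §3.2] -/
theorem IsSecantSequence.ne_zero_of_mem {M : Type u} [AddCommGroup M] [Module R M]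
    (h : IsSecantSequence M xs) : ∀ x ∈ xs, x ≠ 0 := by
  intro x hx h0
  obtain ⟨i, hi, rfl⟩ := List.mem_iff_getElem.mp hx
  have hlt := h i hi
  rw [List.take_succ_eq_append_getElem hi, h0, Ideal.ofList_append, Ideal.ofList_singleton,
    Ideal.span_singleton_eq_bot.mpr rfl, sup_bot_eq] at hlt
  exact lt_irrefl _ hlt

omit [IsDomain R] [IsNoetherianRing R] [IsLocalRing R] in
/-- The denominator of a recursive chart is a product of parameters, hence nonzero when they are.
[folklore] -/
theorem AdmChart.ne_zero [NoZeroDivisors R] (hx0 : ∀ x ∈ xs, x ≠ 0) {p : ℕ} {g c : R}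
    (h : AdmChart xs p g c) : g ≠ 0 ∧ c ≠ 0 := by
  induction h with
  | base h => exact ⟨hx0 _ (List.getElem_mem _), hx0 _ (List.getElem_mem _)⟩
  | new _ hp ih => exact ⟨mul_ne_zero ih.1 (hx0 _ (List.getElem_mem hp)), hx0 _ (List.getElem_mem hp)⟩
  | old _ _ ih => exact ⟨mul_ne_zero ih.1 ih.2, ih.2⟩

set_option maxHeartbeats 800000 in
-- many instances on the blow-up algebra and its localizations
/-- **The recursive charts of Kawasaki's blow-up are Cohen–Macaulay over the closed point**
(Kawasaki 2000, Thm. 4.1 (1) for `M = R`; Česnavičius 2021, Thm. 3.13): for a `p`-standard system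
`xs` of the Noetherian local domain `R` with `dim R ≤ d = |xs|`, a recursive chart `R[I/g]` of
`Bl_I(Spec R)`, `I = ∏_{t<d}(x_{t+1},…,x_d)`, and a prime `𝔴` of `R[I/g]` over `𝔪`, every
localization of `R[I/g]` at `𝔴` satisfies the Cohen–Macaulay clause.
[cite: Kawasaki2000, Thm. 4.1] [cite: Cesnavicius2021, Thm. 3.13] -/
theorem cmClause_of_admChart (hx : IsPStandard R xs) (hd : ringKrullDim R ≤ xs.length)
    {g c : R} (hch : AdmChart xs 0 g c)
    (𝔴 : Ideal (blowupAlgebra (kCentre xs 0) g)) [𝔴.IsPrime]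
    (h𝔴 : 𝔴.comap (algebraMap R (blowupAlgebra (kCentre xs 0) g)) = maximalIdeal R)
    (S : Type u) [CommRing S] [Algebra (blowupAlgebra (kCentre xs 0) g) S]
    [IsLocalization.AtPrime S 𝔴] :
    ∀ n : ℕ, ringKrullDim S = n → ∀ s : Fin n → S,
      (Ideal.span (Set.range s)).radical.IsMaximal → IsWeaklyRegular S (List.ofFn s) := by
  have hx0 : ∀ x ∈ xs, x ≠ 0 := IsSecantSequence.ne_zero_of_mem hx.isSecantSequence
  have hg : g ∈ kCentre xs 0 := hch.mem_kCentre
  have hg0 : g ≠ 0 := (hch.ne_zero hx0).1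
  -- the blow-up algebra: a Noetherian domain, finitely generated and algebraic over `R`
  haveI : IsNoetherianRing (blowupAlgebra (kCentre xs 0) g) :=
    isNoetherianRing_blowupAlgebra_of_isNoetherianRing _ g
  haveI : IsDomain (Localization.Away g) :=
    IsLocalization.isDomain_localization (powers_le_nonZeroDivisors_of_noZeroDivisors hg0)
  haveI : Algebra.IsAlgebraic R (Localization.Away g) := Localization.Away.isAlgebraic_of_ne_zero hg0
  have hinjL : Function.Injective (algebraMap R (Localization.Away g)) :=
    IsLocalization.injective (M := Submonoid.powers g) (Localization.Away g)
      (powers_le_nonZeroDivisors_of_noZeroDivisors hg0)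
  haveI : FaithfulSMul R (blowupAlgebra (kCentre xs 0) g) :=
    (faithfulSMul_iff_algebraMap_injective R _).mpr fun a b hab =>
      hinjL (by
        have := congrArg Subtype.val hab
        exact this)
  haveI : Algebra.FiniteType R (blowupAlgebra (kCentre xs 0) g) :=
    finiteType_blowupAlgebra _ g (IsNoetherian.noetherian _)
  haveI : Algebra.IsAlgebraic R (blowupAlgebra (kCentre xs 0) g) :=
    Algebra.IsAlgebraic.of_injective (blowupAlgebra (kCentre xs 0) g).val Subtype.val_injective
  -- a maximal ideal `𝔔 ⊇ 𝔴`; it lies over `𝔪`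
  obtain ⟨𝔔, h𝔔, h𝔴𝔔⟩ := Ideal.exists_le_maximal 𝔴 (Ideal.IsPrime.ne_top ‹_›)
  have h𝔔m : (maximalIdeal R).map (algebraMap R (blowupAlgebra (kCentre xs 0) g)) ≤ 𝔔 := by
    rw [← h𝔴]
    exact Ideal.map_comap_le.trans h𝔴𝔔
  have h𝔔c : 𝔔.comap (algebraMap R (blowupAlgebra (kCentre xs 0) g)) = maximalIdeal R :=
    ((IsLocalRing.maximalIdeal.isMaximal R).eq_of_le (Ideal.comap_ne_top _ h𝔔.ne_top)
      (Ideal.map_le_iff_le_comap.mp h𝔔m)).symm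
  haveI : 𝔔.LiesOver (maximalIdeal R) := ⟨by rw [Ideal.under_def, h𝔔c]⟩
  -- generators of `𝔔` and the local cohomology vanishing below `d`
  obtain ⟨t, y, hy⟩ := Submodule.fg_iff_exists_fin_generating_family.mp (IsNoetherian.noetherian 𝔔)
  have hyI : Ideal.span (Set.range y) = 𝔔 := hy
  have hys : IsSecantSequence R (xs.drop 0 ++ ([] : List R)) := by
    rw [List.drop_zero, List.append_nil]; exact hx.isSecantSequence
  have hC := hch.cechVanishBelow hx hys (fun _ h => by simp at h) 𝔔 h𝔔 h𝔔m hyI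
  rw [Nat.sub_zero] at hC
  have hC' : CechVanishBelow y (blowupAlgebra (kCentre xs 0) g) xs.length :=
    (hC.of_equiv (chartModuleCongr (kCentre xs 0) g (quotOfListNilEquiv (R := R)))).of_equiv
      (chartModuleSelfEquiv (kCentre xs 0) g hg
        (mem_nonZeroDivisors_of_ne_zero hg0)).symm
  -- CM at `𝔔`: depth `≥ d ≥ dim`
  have hdimL : ringKrullDim (Localization.AtPrime 𝔔) ≤ xs.length :=
    (ringKrullDim_localization_le_of_finiteType_of_isAlgebraic 𝔔 (Localization.AtPrime 𝔔)).trans hd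
  have hL := cmClause_of_cechVanishBelow hyI hC' (Localization.AtPrime 𝔔) hdimL
  -- CM at `𝔴 ⊆ 𝔔`
  exact cmClause_localization_of_le hL h𝔴𝔔 S

set_option maxHeartbeats 800000 in
-- many instances and algebra structures along the chain of charts
omit [IsNoetherianRing R] [IsLocalRing R] in
/-- **Local rings of product charts are local rings of recursive charts**: for an admissible `f`,
a prime `𝔴` of `R[I/G_f]` and a localization `S` at `𝔴`, there are an algebra structure
`R[I/G_{crec f}] → S` and a prime `𝔴₃` of `R[I/G_{crec f}]` with the same contraction to `R` as
`𝔴`, presenting `S` as the localization at `𝔴₃` — through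
`R[I/G_{crec f}] ⊆ R[I/G_f] = R[I/G_{crec f}][(G_f/G_{crec f})⁻¹]` inside `Frac R`
(`KawasakiProductCharts.lean`, `BlowupChartsFractionField.lean`). [cite: StacksProject, Tag 0804]
[cite: Cesnavicius2021, Thm. 3.13 (proof)] -/
theorem exists_isLocalization_atPrime_crec (hx0 : ∀ x ∈ xs, x ≠ 0) (hd0 : 0 < xs.length)
    {f : ℕ → ℕ} (hf : Adm xs f)
    (𝔴 : Ideal (blowupAlgebra (kCentre xs 0) (rawProd xs f 0))) [𝔴.IsPrime]
    (S : Type u) [CommRing S] [Algebra (blowupAlgebra (kCentre xs 0) (rawProd xs f 0)) S]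
    [IsLocalization.AtPrime S 𝔴] :
    ∃ (alg : Algebra (blowupAlgebra (kCentre xs 0) (rawProd xs (crec xs.length f) 0)) S)
      (𝔴₃ : Ideal (blowupAlgebra (kCentre xs 0) (rawProd xs (crec xs.length f) 0)))
      (h₃ : 𝔴₃.IsPrime), @IsLocalization.AtPrime _ _ S _ alg 𝔴₃ h₃ ∧
        𝔴₃.comap (algebraMap R _) =
          𝔴.comap (algebraMap R (blowupAlgebra (kCentre xs 0) (rawProd xs f 0))) := by
  have hG0 : rawProd xs f 0 ≠ 0 := rawProd_ne_zero hx0 f 0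
  have hGr0 : rawProd xs (crec xs.length f) 0 ≠ 0 := rawProd_ne_zero hx0 _ 0
  have hGI : rawProd xs f 0 ∈ kCentre xs 0 := rawProd_mem_kCentre hf hd0
  have hGrI : rawProd xs (crec xs.length f) 0 ∈ kCentre xs 0 := rawProd_mem_kCentre (crec_adm f) hd0
  -- the models inside `Frac R`
  obtain ⟨ef, hef⟩ : ∃ ef : blowupAlgebra (kCentre xs 0) (rawProd xs f 0) ≃ₐ[R]
      fracChart (kCentre xs 0) (rawProd xs f 0), ef = blowupAlgebraEquivFracChart _ hG0 := ⟨_, rfl⟩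
  obtain ⟨er, her⟩ : ∃ er : blowupAlgebra (kCentre xs 0) (rawProd xs (crec xs.length f) 0) ≃ₐ[R]
      fracChart (kCentre xs 0) (rawProd xs (crec xs.length f) 0),
      er = blowupAlgebraEquivFracChart _ hGr0 := ⟨_, rfl⟩
  -- (1) `S` as a localization of `fracChart I G` at `𝔴₁ = ef(𝔴)`
  letI algF : Algebra (fracChart (kCentre xs 0) (rawProd xs f 0)) S :=
    ((algebraMap (blowupAlgebra (kCentre xs 0) (rawProd xs f 0)) S).comp
      ef.toRingEquiv.symm.toRingHom).toAlgebra
  set 𝔴₁ : Ideal (fracChart (kCentre xs 0) (rawProd xs f 0)) :=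
    𝔴.comap ef.toRingEquiv.symm.toRingHom with h𝔴₁
  haveI : 𝔴₁.IsPrime := Ideal.comap_isPrime _ 𝔴
  haveI hloc1 : IsLocalization.AtPrime S 𝔴₁ := by
    have h1 := IsLocalization.isLocalization_of_base_ringEquiv 𝔴.primeCompl S ef.toRingEquiv
    rw [primeCompl_map_ringEquiv_comap_symm] at h1
    exact h1
  -- (2) `S` as a localization of `fracChart I Gr ⊆ fracChart I G` at `𝔴₂ = 𝔴₁ ∩ fracChart I Gr`
  letI algRF : Algebra (fracChart (kCentre xs 0) (rawProd xs (crec xs.length f) 0))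
      (fracChart (kCentre xs 0) (rawProd xs f 0)) :=
    (Subalgebra.inclusion (fracChart_crec_le hx0 hf)).toAlgebra
  letI algR : Algebra (fracChart (kCentre xs 0) (rawProd xs (crec xs.length f) 0)) S :=
    ((algebraMap (fracChart (kCentre xs 0) (rawProd xs f 0)) S).comp
      (algebraMap (fracChart (kCentre xs 0) (rawProd xs (crec xs.length f) 0))
        (fracChart (kCentre xs 0) (rawProd xs f 0)))).toAlgebra
  haveI : IsScalarTower (fracChart (kCentre xs 0) (rawProd xs (crec xs.length f) 0))
      (fracChart (kCentre xs 0) (rawProd xs f 0)) S := IsScalarTower.of_algebraMap_eq fun _ => rfl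
  set 𝔴₂ : Ideal (fracChart (kCentre xs 0) (rawProd xs (crec xs.length f) 0)) :=
    𝔴₁.comap (algebraMap (fracChart (kCentre xs 0) (rawProd xs (crec xs.length f) 0))
      (fracChart (kCentre xs 0) (rawProd xs f 0))) with h𝔴₂
  haveI hloc2 : IsLocalization.AtPrime S 𝔴₂ :=
    isLocalization_atPrime_fracChart (algebraMap_inclusion_coe (fracChart_crec_le hx0 hf))
      hGI hGrI hG0 hGr0 𝔴₁ S
  -- (3) `S` as a localization of `blowupAlgebra I Gr` at `𝔴₃ = er⁻¹(𝔴₂)`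
  letI algB : Algebra (blowupAlgebra (kCentre xs 0) (rawProd xs (crec xs.length f) 0)) S :=
    ((algebraMap (fracChart (kCentre xs 0) (rawProd xs (crec xs.length f) 0)) S).comp
      er.toRingEquiv.symm.symm.toRingHom).toAlgebra
  set 𝔴₃ : Ideal (blowupAlgebra (kCentre xs 0) (rawProd xs (crec xs.length f) 0)) :=
    𝔴₂.comap er.toRingEquiv.symm.symm.toRingHom with h𝔴₃
  haveI h₃ : 𝔴₃.IsPrime := Ideal.comap_isPrime _ 𝔴₂
  haveI hloc3 : @IsLocalization.AtPrime _ _ S _ algB 𝔴₃ _ := by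
    have h3 := IsLocalization.isLocalization_of_base_ringEquiv 𝔴₂.primeCompl S er.toRingEquiv.symm
    rw [primeCompl_map_ringEquiv_comap_symm] at h3
    exact h3
  refine ⟨algB, 𝔴₃, h₃, hloc3, ?_⟩
  -- `𝔴₃` and `𝔴` have the same contraction
  rw [h𝔴₃, h𝔴₂, h𝔴₁]
  simp only [Ideal.comap_comap]
  congr 1
  refine RingHom.ext fun r => ?_
  simp only [RingHom.comp_apply]
  change (ef.toRingEquiv.symm (algebraMap _ (fracChart (kCentre xs 0) (rawProd xs f 0))
    (er.toRingEquiv (algebraMap R _ r))) : _) = algebraMap R _ r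
  rw [AlgEquiv.coe_ringEquiv, AlgEquiv.commutes]
  have : algebraMap _ (fracChart (kCentre xs 0) (rawProd xs f 0))
      (algebraMap R (fracChart (kCentre xs 0) (rawProd xs (crec xs.length f) 0)) r) =
      algebraMap R (fracChart (kCentre xs 0) (rawProd xs f 0)) r :=
    Subtype.ext (by rw [algebraMap_inclusion_coe, Subalgebra.coe_algebraMap,
      Subalgebra.coe_algebraMap])
  rw [this, ← AlgEquiv.symm_toRingEquiv, AlgEquiv.coe_ringEquiv, AlgEquiv.commutes]

/-- **All product charts of Kawasaki's blow-up are Cohen–Macaulay over the closed point**: for an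
admissible `f`, a prime `𝔴` over `𝔪` of `R[I/G_f]`, `G_f = ∏_{t<d} x_{f(t)+1}`, every
localization at `𝔴` satisfies the CM clause — `R[I/G_f]` is a localization of the recursive chart
`R[I/G_{crec f}]` (`KawasakiProductCharts.lean`), so its local rings are local rings of the
latter. [cite: Kawasaki2000, Thm. 4.1] [cite: Cesnavicius2021, Thm. 3.13] -/
theorem cmClause_of_adm (hx : IsPStandard R xs) (hd : ringKrullDim R ≤ xs.length)
    (hd0 : 0 < xs.length) {f : ℕ → ℕ} (hf : Adm xs f)
    (𝔴 : Ideal (blowupAlgebra (kCentre xs 0) (rawProd xs f 0))) [𝔴.IsPrime]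
    (h𝔴 : 𝔴.comap (algebraMap R (blowupAlgebra (kCentre xs 0) (rawProd xs f 0))) = maximalIdeal R)
    (S : Type u) [CommRing S] [Algebra (blowupAlgebra (kCentre xs 0) (rawProd xs f 0)) S]
    [IsLocalization.AtPrime S 𝔴] :
    ∀ n : ℕ, ringKrullDim S = n → ∀ s : Fin n → S,
      (Ideal.span (Set.range s)).radical.IsMaximal → IsWeaklyRegular S (List.ofFn s) := by
  have hx0 : ∀ x ∈ xs, x ≠ 0 := IsSecantSequence.ne_zero_of_mem hx.isSecantSequence
  obtain ⟨alg, 𝔴₃, h₃, hloc, hcomap⟩ := exists_isLocalization_atPrime_crec hx0 hd0 hf 𝔴 S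
  exact @cmClause_of_admChart R _ _ _ _ xs hx hd _ _ (admChart_crec f hd0) 𝔴₃ h₃
    (hcomap.trans h𝔴) S _ alg hloc

/-! ## Part of a system of parameters with Cohen–Macaulay quotient -/

set_option maxHeartbeats 800000 in
-- many instances on the blow-up algebra and its localizations
/-- **Recursive charts, `xs` part of a system of parameters with `R/(xs)` Cohen–Macaulay**
(Kawasaki 2000, Thm. 4.1 "furthermore" and Cor. 4.2 with `t > 1`; Česnavičius 2021, Thm. 3.13 in
the generality of its proof): if `Z ⊆ 𝔪` is `R/(xs)`-(weakly) regular with `xs, Z` a subsystem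
of parameters and `dim R ≤ |xs| + |Z|`, then the local rings of the recursive charts of
`Bl_{I}(Spec R)`, `I = ∏_{t<e}(x_{t+1},…,x_e)`, at primes over `𝔪` satisfy the CM clause.
[cite: Kawasaki2000, Thm. 4.1, Cor. 4.2] [cite: Cesnavicius2021, Thm. 3.13] -/
theorem cmClause_of_admChart_of_isWeaklyRegular (hx : IsPStandard R xs) {Z : List R}
    (hsec : IsSecantSequence R (xs ++ Z)) (hZm : ∀ z ∈ Z, z ∈ maximalIdeal R)
    (hreg : IsWeaklyRegular (R ⧸ Ideal.ofList xs) Z)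
    (hd : ringKrullDim R ≤ xs.length + Z.length)
    {g c : R} (hch : AdmChart xs 0 g c)
    (𝔴 : Ideal (blowupAlgebra (kCentre xs 0) g)) [𝔴.IsPrime]
    (h𝔴 : 𝔴.comap (algebraMap R (blowupAlgebra (kCentre xs 0) g)) = maximalIdeal R)
    (S : Type u) [CommRing S] [Algebra (blowupAlgebra (kCentre xs 0) g) S]
    [IsLocalization.AtPrime S 𝔴] :
    ∀ n : ℕ, ringKrullDim S = n → ∀ s : Fin n → S,
      (Ideal.span (Set.range s)).radical.IsMaximal → IsWeaklyRegular S (List.ofFn s) := by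
  have hx0 : ∀ x ∈ xs, x ≠ 0 := IsSecantSequence.ne_zero_of_mem hx.isSecantSequence
  have hg : g ∈ kCentre xs 0 := hch.mem_kCentre
  have hg0 : g ≠ 0 := (hch.ne_zero hx0).1
  -- the blow-up algebra: a Noetherian domain, finitely generated and algebraic over `R`
  haveI : IsNoetherianRing (blowupAlgebra (kCentre xs 0) g) :=
    isNoetherianRing_blowupAlgebra_of_isNoetherianRing _ g
  haveI : IsDomain (Localization.Away g) :=
    IsLocalization.isDomain_localization (powers_le_nonZeroDivisors_of_noZeroDivisors hg0)
  haveI : Algebra.IsAlgebraic R (Localization.Away g) := Localization.Away.isAlgebraic_of_ne_zero hg0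
  have hinjL : Function.Injective (algebraMap R (Localization.Away g)) :=
    IsLocalization.injective (M := Submonoid.powers g) (Localization.Away g)
      (powers_le_nonZeroDivisors_of_noZeroDivisors hg0)
  haveI : FaithfulSMul R (blowupAlgebra (kCentre xs 0) g) :=
    (faithfulSMul_iff_algebraMap_injective R _).mpr fun a b hab =>
      hinjL (by
        have := congrArg Subtype.val hab
        exact this)
  haveI : Algebra.FiniteType R (blowupAlgebra (kCentre xs 0) g) :=
    finiteType_blowupAlgebra _ g (IsNoetherian.noetherian _)
  haveI : Algebra.IsAlgebraic R (blowupAlgebra (kCentre xs 0) g) :=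
    Algebra.IsAlgebraic.of_injective (blowupAlgebra (kCentre xs 0) g).val Subtype.val_injective
  -- a maximal ideal `𝔔 ⊇ 𝔴`; it lies over `𝔪`
  obtain ⟨𝔔, h𝔔, h𝔴𝔔⟩ := Ideal.exists_le_maximal 𝔴 (Ideal.IsPrime.ne_top ‹_›)
  have h𝔔m : (maximalIdeal R).map (algebraMap R (blowupAlgebra (kCentre xs 0) g)) ≤ 𝔔 := by
    rw [← h𝔴]
    exact Ideal.map_comap_le.trans h𝔴𝔔
  have h𝔔c : 𝔔.comap (algebraMap R (blowupAlgebra (kCentre xs 0) g)) = maximalIdeal R :=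
    ((IsLocalRing.maximalIdeal.isMaximal R).eq_of_le (Ideal.comap_ne_top _ h𝔔.ne_top)
      (Ideal.map_le_iff_le_comap.mp h𝔔m)).symm
  haveI : 𝔔.LiesOver (maximalIdeal R) := ⟨by rw [Ideal.under_def, h𝔔c]⟩
  -- generators of `𝔔` and the local cohomology vanishing below `|xs| + |Z|`
  obtain ⟨t, y, hy⟩ := Submodule.fg_iff_exists_fin_generating_family.mp (IsNoetherian.noetherian 𝔔)
  have hyI : Ideal.span (Set.range y) = 𝔔 := hy
  have hsec' : IsSecantSequence R (xs ++ (([] : List R) ++ Z)) := by rwa [List.nil_append]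
  have hym' : ∀ r ∈ ([] : List R) ++ Z, r ∈ maximalIdeal R := fun r hr => hZm r (by simpa using hr)
  have hreg' : IsWeaklyRegular (R ⧸ (ofList ([] : List R) • ⊤ ⊔ ofList xs • ⊤ : Submodule R R)) Z :=
    (LinearEquiv.isWeaklyRegular_congr (Submodule.quotEquivOfEq _ _ (by
      rw [Ideal.ofList_nil, Submodule.bot_smul, bot_sup_eq, Ideal.smul_eq_mul, Ideal.mul_top])) Z).mpr
      hreg
  have hC := hch.cechVanishBelow_of_isWeaklyRegular hx hsec' hym' hreg' 𝔔 h𝔔 h𝔔m hyI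
  have hC' : CechVanishBelow y (blowupAlgebra (kCentre xs 0) g) (xs.length + Z.length) :=
    (hC.of_equiv (chartModuleCongr (kCentre xs 0) g (quotOfListNilEquiv (R := R)))).of_equiv
      (chartModuleSelfEquiv (kCentre xs 0) g hg
        (mem_nonZeroDivisors_of_ne_zero hg0)).symm
  -- CM at `𝔔`: depth `≥ |xs| + |Z| ≥ dim`
  have hdimL : ringKrullDim (Localization.AtPrime 𝔔) ≤ (xs.length + Z.length : ℕ) :=
    (ringKrullDim_localization_le_of_finiteType_of_isAlgebraic 𝔔 (Localization.AtPrime 𝔔)).trans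
      (by exact_mod_cast hd)
  have hL := cmClause_of_cechVanishBelow hyI hC' (Localization.AtPrime 𝔔) hdimL
  -- CM at `𝔴 ⊆ 𝔔`
  exact cmClause_localization_of_le hL h𝔴𝔔 S

/-- **All product charts, `xs` part of a system of parameters with `R/(xs)` Cohen–Macaulay.**
[cite: Kawasaki2000, Thm. 4.1, Cor. 4.2] [cite: Cesnavicius2021, Thm. 3.13] -/
theorem cmClause_of_adm_of_isWeaklyRegular (hx : IsPStandard R xs) {Z : List R}
    (hsec : IsSecantSequence R (xs ++ Z)) (hZm : ∀ z ∈ Z, z ∈ maximalIdeal R)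
    (hreg : IsWeaklyRegular (R ⧸ Ideal.ofList xs) Z)
    (hd : ringKrullDim R ≤ xs.length + Z.length)
    (hd0 : 0 < xs.length) {f : ℕ → ℕ} (hf : Adm xs f)
    (𝔴 : Ideal (blowupAlgebra (kCentre xs 0) (rawProd xs f 0))) [𝔴.IsPrime]
    (h𝔴 : 𝔴.comap (algebraMap R (blowupAlgebra (kCentre xs 0) (rawProd xs f 0))) = maximalIdeal R)
    (S : Type u) [CommRing S] [Algebra (blowupAlgebra (kCentre xs 0) (rawProd xs f 0)) S]
    [IsLocalization.AtPrime S 𝔴] :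
    ∀ n : ℕ, ringKrullDim S = n → ∀ s : Fin n → S,
      (Ideal.span (Set.range s)).radical.IsMaximal → IsWeaklyRegular S (List.ofFn s) := by
  have hx0 : ∀ x ∈ xs, x ≠ 0 := IsSecantSequence.ne_zero_of_mem hx.isSecantSequence
  obtain ⟨alg, 𝔴₃, h₃, hloc, hcomap⟩ := exists_isLocalization_atPrime_crec hx0 hd0 hf 𝔴 S
  exact @cmClause_of_admChart_of_isWeaklyRegular R _ _ _ _ xs hx Z hsec hZm hreg hd _ _
    (admChart_crec f hd0) 𝔴₃ h₃ (hcomap.trans h𝔴) S _ alg hloc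

end Charts

end Literature.AlgebraicGeometry.Resolution

end
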